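import Mathlib
import HarnessLib
import Literature.Analysis.FluidPDE.SpaceTimeCalculus
import Literature.Analysis.FluidPDE.WeakSolution
import Literature.Analysis.FluidPDE.WholeSpaceIBP
import Summits.NavierStokesRegularity.NavierStokesRegularity.Theorems.ChiralWindowDoorDefs
import Summits.NavierStokesRegularity.NavierStokesRegularity.Theorems.CriticalFluxDoorDefs
import Summits.NavierStokesRegularity.NavierStokesRegularity.Theorems.RellichScarDefs
import Summits.NavierStokesRegularity.NavierStokesRegularity.Theorems.RellichScarSymmetricScarExistsApexScaleInvariantBoundsLemmas
import Summits.NavierStokesRegularity.NavierStokesRegularity.Theorems.CriticalFluxDoorLambdaDeriv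
import Summits.NavierStokesRegularity.NavierStokesRegularity.Theorems.CriticalFluxDoorLambdaSymmetry
import Summits.NavierStokesRegularity.NavierStokesRegularity.Theorems.CriticalFluxDoorPressureIBP
import Summits.NavierStokesRegularity.NavierStokesRegularity.Theorems.CriticalFluxDoorTimeDeriv
import Summits.NavierStokesRegularity.NavierStokesRegularity.Theorems.CriticalFluxDoorCritEnergyDeriv
import Summits.NavierStokesRegularity.NavierStokesRegularity.Theorems.CriticalFluxDoorLambdaCompact

/-!
# Door S21-C «CriticalFluxDoor» — THE WINDOWED CRITICAL-ENERGY IDENTITY in dissipation form (F3-DERIVATION §1):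
# `d/dt Q(a, v) = 2∫q ∇a·Λv − 2∑ᵢ∫∂ᵢa⟪∂ᵢv, Λv⟫ − 2∑ᵢ Q(a, ∂ᵢv) − 2∫aΦ(v) + ∫⟪[Λ,a]v, ∂ₜv⟫`

Door S21-C of nsreg-p1's local Type-I door family (`HOME/ns-regularity-ideate-p1/ROUND-20.md` §2b F3,
`r20/F3-DERIVATION.md` §1; DESIGN-ONLY, route NOT born).  For a classical unit-viscosity solution `(v, q)` on the open
backward time axis with the tree's scale-invariant package `ScaleInvariantBounds v q` and a compactly supported `C²` weight
`a`, the raw derivative `∫a(⟪∂ₜv, Λv⟫ + ⟪v, Λ∂ₜv⟫)` of `…CritEnergyDeriv.hasDerivAt_critEnergy` is rewritten: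

1. `∫a⟪v, Λ∂ₜv⟫ = ∫⟪Λ(a v), ∂ₜv⟫ = ∫a⟪Λv, ∂ₜv⟫ + ∫⟪[Λ,a]v, ∂ₜv⟫` (`Λ` symmetric, E7; commutator split, E9; the commutator
   pairing is a genuine integral over `ℝ³` because `Λ(a v) ∈ L¹`, `…LambdaCompact`);
2. `∂ₜv = Δv − ∇q − (v·∇)v` (momentum, tree `timeDeriv_eq_of_classical`) inside `2∫a⟪∂ₜv, Λv⟫`:
   the transfer term is `−2∫aΦ(v)` (`Φ = fluxDensity`), the pressure term is `+2∫q ∇a·Λv` (E11, `div Λv = 0`), and the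
   viscous term is `−2∑ᵢ∫∂ᵢa⟪∂ᵢv,Λv⟫ − 2∑ᵢQ(a,∂ᵢv)` (Green's identity of the tree's `WholeSpaceIBP` against the `C¹_c` field
   `aΛv`, with `∂ᵢΛv = Λ∂ᵢv`, E6).

* `integral_mul_inner_fracLapHalf_timeDeriv` — step 1;
* `integral_mul_inner_laplacian_fracLapHalf` — the viscous term; `integral_mul_inner_gradient_fracLapHalf` — the pressure term;
* `hasDerivAt_critEnergy_dissipation` — **the identity.**

Seat nsreg-p6 g13 (THEOREMS-ONLY door sequels, DIRECTOR-NS g8 #32 (2)/#36).  WHAT THIS IS NOT: not NS regularity (Clay A);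
an exact identity for smooth solutions — not yet the flux BOUNDS of F3; no route is opened.
-/

noncomputable section

-- the summit and its single sub-problem share the name (CONVENTIONS §1), as in every Theorems file
set_option linter.dupNamespace false

namespace Summit.NavierStokesRegularity.NavierStokesRegularity.Theorems.CriticalFluxDoorCritEnergyIdentity

open MeasureTheory Metric Set Filter Topology Function InnerProductSpace
open scoped RealInnerProductSpace Laplacian
open Literature.Analysis Literature.Analysis.FluidPDE
open Summit.NavierStokesRegularity.NavierStokesRegularity.Theorems.ChiralWindowDoorDefs
open Summit.NavierStokesRegularity.NavierStokesRegularity.Theorems.CriticalFluxDoorDefs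
open Summit.NavierStokesRegularity.NavierStokesRegularity.Theorems.RellichScarScarRigidity (ScaleInvariantBounds)
open Summit.NavierStokesRegularity.NavierStokesRegularity.Theorems.SymmetricScarExists.LogtimeBernoulli
  (timeDeriv_eq_of_classical)
open Summit.NavierStokesRegularity.NavierStokesRegularity.Theorems.CriticalFluxDoorLambdaDeriv (fderiv_fracLapHalf_apply)
open Summit.NavierStokesRegularity.NavierStokesRegularity.Theorems.CriticalFluxDoorLambdaSymmetry
  (integral_inner_fracLapHalf_comm fracLapHalf_smul_eq_lamComm)
open Summit.NavierStokesRegularity.NavierStokesRegularity.Theorems.CriticalFluxDoorPressureIBP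
  (integral_mul_fderiv_apply_eq_neg_of_divFree)
open Summit.NavierStokesRegularity.NavierStokesRegularity.Theorems.CriticalFluxDoorTimeDeriv
  (contDiff_timeDeriv exists_timeDeriv_bound)
open Summit.NavierStokesRegularity.NavierStokesRegularity.Theorems.CriticalFluxDoorCritEnergyDeriv
  (hasDerivAt_critEnergy continuous_fracLapHalf_of_bounds)
open Summit.NavierStokesRegularity.NavierStokesRegularity.Theorems.CriticalFluxDoorLambdaCompact
  (integrable_fracLapHalf_of_hasCompactSupport continuous_fracLapHalf_of_hasCompactSupport fracLapHalf_regular_of_bounds)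

variable {v : ℝ → EuclideanSpace ℝ (Fin 3) → EuclideanSpace ℝ (Fin 3)} {q : ℝ → EuclideanSpace ℝ (Fin 3) → ℝ}
  {a : EuclideanSpace ℝ (Fin 3) → ℝ}

/-! ### Global sup bounds for one slice (from the scale-invariant package) -/

/-- A scale-invariant bound `L/(‖y‖+√(−s))^k` at a fixed time `s < 0` is an `x`-uniform bound `|L|/√(−s)^k`. -/
theorem unif_of_scaleInvariant_slice {g : EuclideanSpace ℝ (Fin 3) → ℝ} {L : ℝ} {k : ℕ} {s : ℝ} (hs : s < 0)
    (h : ∀ y : EuclideanSpace ℝ (Fin 3), g y ≤ L / (‖y‖ + Real.sqrt (-s)) ^ k) (y : EuclideanSpace ℝ (Fin 3)) :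
    g y ≤ |L| / Real.sqrt (-s) ^ k := by
  have hsq : 0 < Real.sqrt (-s) := Real.sqrt_pos.2 (neg_pos.2 hs)
  calc g y ≤ L / (‖y‖ + Real.sqrt (-s)) ^ k := h y
    _ ≤ |L| / (‖y‖ + Real.sqrt (-s)) ^ k := div_le_div_of_nonneg_right (le_abs_self L) (by positivity)
    _ ≤ |L| / Real.sqrt (-s) ^ k := div_le_div_of_nonneg_left (abs_nonneg L) (by positivity)
        (pow_le_pow_left₀ hsq.le (by linarith [norm_nonneg y]) k)

/-- Sup bounds of orders `0…4` for the slice `v t` and of orders `0…3` for `∂ₜv(t)`, `t < 0`. -/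
theorem slice_bounds (hsol : IsClassicalNSSolutionOn (Iio (0 : ℝ)) 1 0 v q) (hSIB : ScaleInvariantBounds v q) {t : ℝ}
    (ht : t < 0) :
    ∃ M N : ℕ → ℝ, (∀ n ≤ 4, ∀ y : EuclideanSpace ℝ (Fin 3), ‖iteratedFDeriv ℝ n (v t) y‖ ≤ M n) ∧
      ∀ n ≤ 3, ∀ y : EuclideanSpace ℝ (Fin 3), ‖iteratedFDeriv ℝ n (timeDeriv v t) y‖ ≤ N n := by
  have h := fun n => exists_timeDeriv_bound hsol hSIB n
  choose W hW using h
  choose L hL using hSIB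
  refine ⟨fun n => |L n| / Real.sqrt (-t) ^ (1 + n), fun n => |W n| / Real.sqrt (-t) ^ (3 + n),
    fun n _ y => ?_, fun n _ y => ?_⟩
  · exact unif_of_scaleInvariant_slice (g := fun y => ‖iteratedFDeriv ℝ n (v t) y‖) ht (fun y => (hL n t ht y).1) y
  · exact unif_of_scaleInvariant_slice (g := fun y => ‖iteratedFDeriv ℝ n (timeDeriv v t) y‖) ht (hW n t ht) y

/-! ### Step 1: `∫a⟪v, Λ∂ₜv⟫ = ∫a⟪Λv, ∂ₜv⟫ + ∫⟪[Λ,a]v, ∂ₜv⟫` -/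

/-- **`∫a⟪v, Λ∂ₜv⟫ = ∫a⟪Λv, ∂ₜv⟫ + ∫⟪[Λ,a]v, ∂ₜv⟫`** (`Λ` symmetric against the `C²_c` field `a v`, then the commutator
split; every integral is genuine). -/
theorem integral_mul_inner_fracLapHalf_timeDeriv (hsol : IsClassicalNSSolutionOn (Iio (0 : ℝ)) 1 0 v q)
    (hSIB : ScaleInvariantBounds v q) (ha : ContDiff ℝ 2 a) (hac : HasCompactSupport a) {t : ℝ} (ht : t < 0) :
    ∫ x, a x * ⟪v t x, fracLapHalf (timeDeriv v t) x⟫ =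
      (∫ x, a x * ⟪fracLapHalf (v t) x, timeDeriv v t x⟫) + ∫ x, ⟪lamComm a (v t) x, timeDeriv v t x⟫ := by
  obtain ⟨M, N, hM, hN⟩ := slice_bounds hsol hSIB ht
  have hvC : ContDiff ℝ 3 (v t) := contDiff_infty.1 (hsol.contDiff_velocity ht) 3
  have hv2 : ContDiff ℝ 2 (v t) := hvC.of_le (by norm_cast)
  have hwC : ContDiff ℝ 3 (timeDeriv v t) := contDiff_timeDeriv hsol ht 3
  have hw2 : ContDiff ℝ 2 (timeDeriv v t) := hwC.of_le (by norm_cast)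
  have hM0 : ∀ y, ‖v t y‖ ≤ M 0 := fun y => by have h := hM 0 (by norm_num) y; rwa [norm_iteratedFDeriv_zero] at h
  have hM1 : ∀ y, ‖fderiv ℝ (v t) y‖ ≤ M 1 := fun y => by have h := hM 1 (by norm_num) y; rwa [norm_iteratedFDeriv_one] at h
  have hN0 : ∀ y, ‖timeDeriv v t y‖ ≤ N 0 := fun y => by
    have h := hN 0 (by norm_num) y; rwa [norm_iteratedFDeriv_zero] at h
  -- the compactly supported field `a v` and its second derivatives
  set f : EuclideanSpace ℝ (Fin 3) → EuclideanSpace ℝ (Fin 3) := fun y => a y • v t y with hf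
  have hfC : ContDiff ℝ 2 f := ha.smul hv2
  have hfs : HasCompactSupport f := hac.smul_right
  obtain ⟨A, hA⟩ := ((hfC.continuous_iteratedFDeriv (m := 2) le_rfl).norm).bounded_above_of_compact_support
    (hfs.iteratedFDeriv 2).norm
  have hf2 : ∀ y, ‖iteratedFDeriv ℝ 2 f y‖ ≤ A := fun y => (le_abs_self _).trans ((Real.norm_eq_abs _).symm.le.trans (hA y))
  -- symmetry: `∫⟪Λ(a v), ∂ₜv⟫ = ∫⟪a v, Λ∂ₜv⟫`
  have hsym := integral_inner_fracLapHalf_comm hfC hfs hf2 hw2 hN0 (hN 2 (by norm_num))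
  -- commutator split, pointwise
  have hsplit : ∀ x, fracLapHalf f x = a x • fracLapHalf (v t) x + lamComm a (v t) x := fun x =>
    fracLapHalf_smul_eq_lamComm ha hac hv2 hM0 (hM 2 (by norm_num)) x
  -- integrability of the two pieces of `⟪Λ(a v), ∂ₜv⟫`
  have hΛvc : Continuous (fracLapHalf (v t)) :=
    continuous_fracLapHalf_of_bounds hvC hM0 hM1 (hM 2 (by norm_num)) (hM 3 (by norm_num))
  have hwc : Continuous (timeDeriv v t) := hwC.continuous
  have hI1 : Integrable (fun x => a x * ⟪fracLapHalf (v t) x, timeDeriv v t x⟫) :=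
    (ha.continuous.mul (hΛvc.inner hwc)).integrable_of_hasCompactSupport hac.mul_right
  have hΛfi : Integrable (fracLapHalf f) := integrable_fracLapHalf_of_hasCompactSupport hfC hfs
  have hcomm_int : Integrable (fun x => ⟪lamComm a (v t) x, timeDeriv v t x⟫) := by
    have heq : (fun x => ⟪lamComm a (v t) x, timeDeriv v t x⟫) =
        fun x => ⟪fracLapHalf f x, timeDeriv v t x⟫ - a x * ⟪fracLapHalf (v t) x, timeDeriv v t x⟫ := by
      funext x
      rw [hsplit x, inner_add_left, real_inner_smul_left]
      ring
    rw [heq]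
    refine Integrable.sub ?_ hI1
    -- `⟪Λf, w⟫` with `Λf ∈ L¹`, `w` bounded continuous
    have hΛfc : Continuous (fracLapHalf f) := continuous_fracLapHalf_of_hasCompactSupport hfC hfs
    refine Integrable.mono' (hΛfi.norm.mul_const (N 0)) (hΛfc.inner hwc).aestronglyMeasurable
      (ae_of_all _ fun x => ?_)
    rw [Real.norm_eq_abs]
    exact (abs_real_inner_le_norm _ _).trans (mul_le_mul_of_nonneg_left (hN0 x) (norm_nonneg _))
  -- assemble
  have hL : ∫ x, a x * ⟪v t x, fracLapHalf (timeDeriv v t) x⟫ = ∫ x, ⟪f x, fracLapHalf (timeDeriv v t) x⟫ := by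
    refine integral_congr_ae (ae_of_all _ fun x => ?_)
    show a x * ⟪v t x, fracLapHalf (timeDeriv v t) x⟫ = ⟪a x • v t x, fracLapHalf (timeDeriv v t) x⟫
    rw [real_inner_smul_left]
  rw [hL, ← hsym]
  have hR : (fun x => ⟪fracLapHalf f x, timeDeriv v t x⟫) =
      fun x => a x * ⟪fracLapHalf (v t) x, timeDeriv v t x⟫ + ⟪lamComm a (v t) x, timeDeriv v t x⟫ := by
    funext x
    rw [hsplit x, inner_add_left, real_inner_smul_left]
  rw [hR, integral_add hI1 hcomm_int]

/-! ### Step 2: the viscous and the pressure terms -/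

/-- **The viscous term**: `∫a⟪Δv, Λv⟫ = −∑ᵢ∫ ∂ᵢa·⟪∂ᵢv, Λv⟫ − ∑ᵢ Q(a, ∂ᵢv)` (Green's identity against `aΛv ∈ C¹_c`,
`∂ᵢ(aΛv) = ∂ᵢa Λv + a Λ∂ᵢv`). -/
theorem integral_mul_inner_laplacian_fracLapHalf (hsol : IsClassicalNSSolutionOn (Iio (0 : ℝ)) 1 0 v q)
    (hSIB : ScaleInvariantBounds v q) (ha : ContDiff ℝ 2 a) (hac : HasCompactSupport a) {t : ℝ} (ht : t < 0) :
    ∫ x, a x * ⟪(Δ (v t)) x, fracLapHalf (v t) x⟫ =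
      -(∑ i : Fin 3, ∫ x, fderiv ℝ a x (EuclideanSpace.single i 1) * ⟪pderiv i (v t) x, fracLapHalf (v t) x⟫)
        - ∑ i : Fin 3, critEnergy a (pderiv i (v t)) := by
  obtain ⟨M, N, hM, -⟩ := slice_bounds hsol hSIB ht
  have hvC : ContDiff ℝ 4 (v t) := contDiff_infty.1 (hsol.contDiff_velocity ht) 4
  have hv3 : ContDiff ℝ 3 (v t) := hvC.of_le (by norm_cast)
  have hv2 : ContDiff ℝ 2 (v t) := hvC.of_le (by norm_cast)
  have hM0 : ∀ y, ‖v t y‖ ≤ M 0 := fun y => by have h := hM 0 (by norm_num) y; rwa [norm_iteratedFDeriv_zero] at h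
  have hM1' : ∀ y, ‖fderiv ℝ (v t) y‖ ≤ M 1 := fun y => by
    have h := hM 1 (by norm_num) y; rwa [norm_iteratedFDeriv_one] at h
  obtain ⟨hΛC1, hpart, hpartc, -⟩ := fracLapHalf_regular_of_bounds hvC hM0 (hM 1 (by norm_num)) (hM 2 (by norm_num))
    (hM 3 (by norm_num)) (hM 4 (by norm_num)) (hsol.divFree t ht)
  have hΛc : Continuous (fracLapHalf (v t)) := hΛC1.continuous
  have hΛd : Differentiable ℝ (fracLapHalf (v t)) := hΛC1.differentiable (by norm_num)
  -- the test field `w = a Λv ∈ C¹_c`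
  set w : EuclideanSpace ℝ (Fin 3) → EuclideanSpace ℝ (Fin 3) := fun x => a x • fracLapHalf (v t) x with hw
  have ha1 : ContDiff ℝ 1 a := ha.of_le (by norm_cast)
  have hwC : ContDiff ℝ 1 w := ha1.smul hΛC1
  have hws : HasCompactSupport w := hac.smul_right
  -- Green's identity (tree `WholeSpaceIBP`)
  have hgreen := integral_inner_laplacian_add_eq_zero (EuclideanSpace.basisFun (Fin 3) ℝ) hv2 hwC (Or.inr hws)
  simp only [EuclideanSpace.basisFun_apply] at hgreen
  -- the left side: `⟪Δv, a Λv⟫ = a ⟪Δv, Λv⟫`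
  have hL : ∫ x, ⟪(Δ (v t)) x, w x⟫ = ∫ x, a x * ⟪(Δ (v t)) x, fracLapHalf (v t) x⟫ :=
    integral_congr_ae (ae_of_all _ fun x => by simp only [hw, real_inner_smul_right])
  -- the partial derivatives of `w`
  have hDw : ∀ i x, fderiv ℝ w x (EuclideanSpace.single i 1) =
      fderiv ℝ a x (EuclideanSpace.single i 1) • fracLapHalf (v t) x + a x • fracLapHalf (pderiv i (v t)) x := by
    intro i x
    have had : DifferentiableAt ℝ a x := ha1.differentiable (by norm_num) x
    rw [hw, fderiv_fun_smul had (hΛd x), add_apply, smul_apply,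
      ContinuousLinearMap.smulRight_apply, hpart x]
    have hp : (fun y => fderiv ℝ (v t) y (EuclideanSpace.single i 1)) = pderiv i (v t) :=
      funext fun y => (pderiv_eq i (v t) y).symm
    rw [hp, add_comm]
  -- each summand
  have hterm : ∀ i : Fin 3, ∫ x, ⟪fderiv ℝ (v t) x (EuclideanSpace.single i 1), fderiv ℝ w x (EuclideanSpace.single i 1)⟫ =
      (∫ x, fderiv ℝ a x (EuclideanSpace.single i 1) * ⟪pderiv i (v t) x, fracLapHalf (v t) x⟫) +
        critEnergy a (pderiv i (v t)) := by
    intro i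
    have hpc : Continuous (pderiv i (v t)) := by
      have : pderiv i (v t) = fun y => fderiv ℝ (v t) y (EuclideanSpace.single i 1) := funext fun y => pderiv_eq i (v t) y
      rw [this]; exact (hv2.continuous_fderiv (by norm_num)).clm_apply continuous_const
    have hΛpc : Continuous (fracLapHalf (pderiv i (v t))) := by
      have : fracLapHalf (pderiv i (v t)) = fun x => fderiv ℝ (fracLapHalf (v t)) x (EuclideanSpace.single i 1) := by
        funext x; rw [hpart x]
        exact congrArg (fun g => fracLapHalf g x) (funext fun y => pderiv_eq i (v t) y)
      rw [this]; exact hpartc _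
    have hDac : Continuous fun x => fderiv ℝ a x (EuclideanSpace.single i 1) :=
      (ha1.continuous_fderiv (by norm_num)).clm_apply continuous_const
    have hI1 : Integrable fun x => fderiv ℝ a x (EuclideanSpace.single i 1) * ⟪pderiv i (v t) x, fracLapHalf (v t) x⟫ :=
      (hDac.mul (hpc.inner hΛc)).integrable_of_hasCompactSupport
        ((hac.fderiv_apply (𝕜 := ℝ) (EuclideanSpace.single i 1)).mul_right)
    have hI2 : Integrable fun x => a x * ⟪pderiv i (v t) x, fracLapHalf (pderiv i (v t)) x⟫ :=
      (ha.continuous.mul (hpc.inner hΛpc)).integrable_of_hasCompactSupport hac.mul_right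
    rw [critEnergy_eq, ← integral_add hI1 hI2]
    refine integral_congr_ae (ae_of_all _ fun x => ?_)
    show ⟪fderiv ℝ (v t) x (EuclideanSpace.single i 1), fderiv ℝ w x (EuclideanSpace.single i 1)⟫ = _
    rw [hDw i x, ← pderiv_eq, inner_add_right, real_inner_smul_right, real_inner_smul_right]
  rw [← hL]
  have hsum : ∑ i : Fin 3, ∫ x, ⟪fderiv ℝ (v t) x (EuclideanSpace.single i 1), fderiv ℝ w x (EuclideanSpace.single i 1)⟫ =
      (∑ i : Fin 3, ∫ x, fderiv ℝ a x (EuclideanSpace.single i 1) * ⟪pderiv i (v t) x, fracLapHalf (v t) x⟫) +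
        ∑ i : Fin 3, critEnergy a (pderiv i (v t)) := by
    rw [← Finset.sum_add_distrib]; exact Finset.sum_congr rfl fun i _ => hterm i
  linarith [hgreen, hsum]

/-- **The pressure term**: `∫a⟪∇q, Λv⟫ = −∫ q ∇a·Λv` (`div Λv = 0`; E11). -/
theorem integral_mul_inner_gradient_fracLapHalf (hsol : IsClassicalNSSolutionOn (Iio (0 : ℝ)) 1 0 v q)
    (hSIB : ScaleInvariantBounds v q) (ha : ContDiff ℝ 2 a) (hac : HasCompactSupport a) {t : ℝ} (ht : t < 0) :
    ∫ x, a x * ⟪gradient (q t) x, fracLapHalf (v t) x⟫ = -∫ x, q t x * fderiv ℝ a x (fracLapHalf (v t) x) := by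
  obtain ⟨M, N, hM, -⟩ := slice_bounds hsol hSIB ht
  have hvC : ContDiff ℝ 4 (v t) := contDiff_infty.1 (hsol.contDiff_velocity ht) 4
  have hM0 : ∀ y, ‖v t y‖ ≤ M 0 := fun y => by have h := hM 0 (by norm_num) y; rwa [norm_iteratedFDeriv_zero] at h
  obtain ⟨hΛC1, -, hpartc, hdivΛ⟩ := fracLapHalf_regular_of_bounds hvC hM0 (hM 1 (by norm_num)) (hM 2 (by norm_num))
    (hM 3 (by norm_num)) (hM 4 (by norm_num)) (hsol.divFree t ht)
  have hq1 : ContDiff ℝ 1 (q t) := (hsol.contDiff_pressure ht).of_le (by exact_mod_cast le_top)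
  have h := integral_mul_fderiv_apply_eq_neg_of_divFree (ha.of_le (by norm_cast)) hac hq1 (hΛC1.differentiable (by norm_num))
    (fun i => hpartc _) hdivΛ
  rw [← h]
  refine integral_congr_ae (ae_of_all _ fun x => ?_)
  show a x * ⟪gradient (q t) x, fracLapHalf (v t) x⟫ = a x * fderiv ℝ (q t) x (fracLapHalf (v t) x)
  rw [gradient, toDual_symm_apply]

/-! ### The identity -/

/-- **The raw derivative in dissipation form** (a real-number identity at a fixed `t < 0`):
`∫a(⟪∂ₜv,Λv⟫ + ⟪v,Λ∂ₜv⟫) = 2∫q ∇a·Λv − 2∑ᵢ∫∂ᵢa⟪∂ᵢv,Λv⟫ − 2∑ᵢQ(a,∂ᵢv) − 2∫aΦ(v) + ∫⟪[Λ,a]v, ∂ₜv⟫`. -/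
theorem integral_rawDeriv_eq_dissipation (hsol : IsClassicalNSSolutionOn (Iio (0 : ℝ)) 1 0 v q)
    (hSIB : ScaleInvariantBounds v q) (ha : ContDiff ℝ 2 a) (hac : HasCompactSupport a) {t : ℝ} (ht : t < 0) :
    ∫ x, a x * (⟪timeDeriv v t x, fracLapHalf (v t) x⟫ + ⟪v t x, fracLapHalf (timeDeriv v t) x⟫) =
      2 * (∫ x, q t x * fderiv ℝ a x (fracLapHalf (v t) x))
        - 2 * (∑ i : Fin 3, ∫ x, fderiv ℝ a x (EuclideanSpace.single i 1) * ⟪pderiv i (v t) x, fracLapHalf (v t) x⟫)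
        - 2 * (∑ i : Fin 3, critEnergy a (pderiv i (v t)))
        - 2 * (∫ x, a x * fluxDensity (v t) x)
        + ∫ x, ⟪lamComm a (v t) x, timeDeriv v t x⟫ := by
  obtain ⟨M, N, hM, hN⟩ := slice_bounds hsol hSIB ht
  have hvC : ContDiff ℝ 4 (v t) := contDiff_infty.1 (hsol.contDiff_velocity ht) 4
  have hv3 : ContDiff ℝ 3 (v t) := hvC.of_le (by norm_cast)
  have hv2 : ContDiff ℝ 2 (v t) := hvC.of_le (by norm_cast)
  have hwC : ContDiff ℝ 3 (timeDeriv v t) := contDiff_timeDeriv hsol ht 3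
  have hM0 : ∀ y, ‖v t y‖ ≤ M 0 := fun y => by have h := hM 0 (by norm_num) y; rwa [norm_iteratedFDeriv_zero] at h
  have hM1 : ∀ y, ‖fderiv ℝ (v t) y‖ ≤ M 1 := fun y => by have h := hM 1 (by norm_num) y; rwa [norm_iteratedFDeriv_one] at h
  have hN0 : ∀ y, ‖timeDeriv v t y‖ ≤ N 0 := fun y => by
    have h := hN 0 (by norm_num) y; rwa [norm_iteratedFDeriv_zero] at h
  have hN1 : ∀ y, ‖fderiv ℝ (timeDeriv v t) y‖ ≤ N 1 := fun y => by
    have h := hN 1 (by norm_num) y; rwa [norm_iteratedFDeriv_one] at h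
  have hΛvc : Continuous (fracLapHalf (v t)) :=
    continuous_fracLapHalf_of_bounds hv3 hM0 hM1 (hM 2 (by norm_num)) (hM 3 (by norm_num))
  have hΛwc : Continuous (fracLapHalf (timeDeriv v t)) :=
    continuous_fracLapHalf_of_bounds hwC hN0 hN1 (hN 2 (by norm_num)) (hN 3 (by norm_num))
  have hvc : Continuous (v t) := hv2.continuous
  have hwc : Continuous (timeDeriv v t) := hwC.continuous
  have hac' : Continuous a := ha.continuous
  -- split the raw derivative
  have hI1 : Integrable fun x => a x * ⟪timeDeriv v t x, fracLapHalf (v t) x⟫ :=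
    (hac'.mul (hwc.inner hΛvc)).integrable_of_hasCompactSupport hac.mul_right
  have hI2 : Integrable fun x => a x * ⟪v t x, fracLapHalf (timeDeriv v t) x⟫ :=
    (hac'.mul (hvc.inner hΛwc)).integrable_of_hasCompactSupport hac.mul_right
  have hsplit : ∫ x, a x * (⟪timeDeriv v t x, fracLapHalf (v t) x⟫ + ⟪v t x, fracLapHalf (timeDeriv v t) x⟫) =
      (∫ x, a x * ⟪timeDeriv v t x, fracLapHalf (v t) x⟫) + ∫ x, a x * ⟪v t x, fracLapHalf (timeDeriv v t) x⟫ := by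
    rw [← integral_add hI1 hI2]
    exact integral_congr_ae (ae_of_all _ fun x => by ring)
  -- step 1
  have hstep1 := integral_mul_inner_fracLapHalf_timeDeriv hsol hSIB ha hac ht
  have hcomm' : ∫ x, a x * ⟪fracLapHalf (v t) x, timeDeriv v t x⟫ = ∫ x, a x * ⟪timeDeriv v t x, fracLapHalf (v t) x⟫ :=
    integral_congr_ae (ae_of_all _ fun x => by dsimp only; rw [real_inner_comm])
  -- step 2: insert the equation into `∫a⟪∂ₜv, Λv⟫`
  have heq : ∀ x, timeDeriv v t x = (Δ (v t)) x - gradient (q t) x - fderiv ℝ (v t) x (v t x) := fun x => by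
    have h := congrFun (timeDeriv_eq_of_classical hsol ht) x
    rw [h]; rfl
  have hΔc : Continuous (Δ (v t)) := continuous_laplacian hv2
  have hgc : Continuous (gradient (q t)) :=
    continuous_gradient_of_contDiff ((hsol.contDiff_pressure ht).of_le (by exact_mod_cast le_top))
  have hNc : Continuous fun x => fderiv ℝ (v t) x (v t x) := (hv2.continuous_fderiv (by norm_num)).clm_apply hvc
  set FA : EuclideanSpace ℝ (Fin 3) → ℝ := fun x => a x * ⟪(Δ (v t)) x, fracLapHalf (v t) x⟫ with hFA
  set FB : EuclideanSpace ℝ (Fin 3) → ℝ := fun x => a x * ⟪gradient (q t) x, fracLapHalf (v t) x⟫ with hFB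
  set FC : EuclideanSpace ℝ (Fin 3) → ℝ := fun x => a x * ⟪fderiv ℝ (v t) x (v t x), fracLapHalf (v t) x⟫ with hFC
  have hJ1 : Integrable FA := (hac'.mul (hΔc.inner hΛvc)).integrable_of_hasCompactSupport hac.mul_right
  have hJ2 : Integrable FB := (hac'.mul (hgc.inner hΛvc)).integrable_of_hasCompactSupport hac.mul_right
  have hJ3 : Integrable FC := (hac'.mul (hNc.inner hΛvc)).integrable_of_hasCompactSupport hac.mul_right
  have hJ12 : Integrable (fun x => FA x - FB x) := hJ1.sub hJ2
  have hins : ∫ x, a x * ⟪timeDeriv v t x, fracLapHalf (v t) x⟫ = (∫ x, FA x) - (∫ x, FB x) - ∫ x, FC x := by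
    have h1 : (fun x => a x * ⟪timeDeriv v t x, fracLapHalf (v t) x⟫) = fun x => (FA x - FB x) - FC x := by
      funext x
      simp only [hFA, hFB, hFC]
      rw [heq x, inner_sub_left, inner_sub_left]
      ring
    calc ∫ x, a x * ⟪timeDeriv v t x, fracLapHalf (v t) x⟫ = ∫ x, ((FA x - FB x) - FC x) := by rw [h1]
      _ = (∫ x, (FA x - FB x)) - ∫ x, FC x := integral_sub hJ12 hJ3
      _ = _ := by rw [integral_sub hJ1 hJ2]
  -- the transfer term is `∫ a Φ(v)`
  have hT : ∫ x, FC x = ∫ x, a x * fluxDensity (v t) x :=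
    integral_congr_ae (ae_of_all _ fun x => by simp only [hFC]; rw [fluxDensity_eq, real_inner_comm])
  have hvisc := integral_mul_inner_laplacian_fracLapHalf hsol hSIB ha hac ht
  have hpress := integral_mul_inner_gradient_fracLapHalf hsol hSIB ha hac ht
  linarith [hsplit, hstep1, hcomm', hins, hT, hvisc, hpress]

/-- **THE WINDOWED CRITICAL-ENERGY IDENTITY (dissipation form).**  For a classical unit-viscosity solution on the open
backward axis with the scale-invariant package and a compactly supported `C²` weight `a`, on `t < 0`:
`d/dt Q(a, v(t)) = 2∫q ∇a·Λv − 2∑ᵢ∫∂ᵢa⟪∂ᵢv,Λv⟫ − 2∑ᵢQ(a,∂ᵢv) − 2∫aΦ(v) + ∫⟪[Λ,a]v, ∂ₜv⟫`. -/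
theorem hasDerivAt_critEnergy_dissipation (hsol : IsClassicalNSSolutionOn (Iio (0 : ℝ)) 1 0 v q)
    (hSIB : ScaleInvariantBounds v q) (ha : ContDiff ℝ 2 a) (hac : HasCompactSupport a) {t : ℝ} (ht : t < 0) :
    HasDerivAt (fun s => critEnergy a (v s))
      (2 * (∫ x, q t x * fderiv ℝ a x (fracLapHalf (v t) x))
        - 2 * (∑ i : Fin 3, ∫ x, fderiv ℝ a x (EuclideanSpace.single i 1) * ⟪pderiv i (v t) x, fracLapHalf (v t) x⟫)
        - 2 * (∑ i : Fin 3, critEnergy a (pderiv i (v t)))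
        - 2 * (∫ x, a x * fluxDensity (v t) x)
        + ∫ x, ⟪lamComm a (v t) x, timeDeriv v t x⟫) t :=
  (hasDerivAt_critEnergy hsol hSIB ha.continuous hac ht).congr_deriv
    (integral_rawDeriv_eq_dissipation hsol hSIB ha hac ht)

end Summit.NavierStokesRegularity.NavierStokesRegularity.Theorems.CriticalFluxDoorCritEnergyIdentity

end
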